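/-
Copyright (c) 2026 the pub-hodgecm-mathlib formalisation cell (harness21).  Prover seat hodgecm-mathlib-K2E3-p17 (g10), HCML Track B «K2-LIT» ∕ h413
(`stmt-HodgeConjecture-24833`), R90-TF section S3 hand S3-p13 «JUNCTION-FIRST for E's print socket 6» (dealt BY NAME by R90-C12-plan (g0), RULING S3-R10 (3),
2026-09-04T22:21:11Z).  2026-09-04.
-/
import Literature.NumberTheory.Rogawski1990.SmoothTransferSplitPlaceNamed               -- ★ brings `UnitaryGroup.cmSplitTransfer`, `cmSplitMaxCompact`, `splitKUMeasure`, `localSplitEquiv` (L. 4.13.1 (a) named transfer)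
import Literature.NumberTheory.Rogawski1990.LocalTransferFundamentalLemma                 -- ★ `IsLocSmooth`
import Literature.NumberTheory.Automorphic.SmoothCharacter                               -- ★ `Representation.smoothTrace`, `IrrClass.smoothTrace`, `SmoothIrrep`
import Literature.NumberTheory.Automorphic.VanDijkTraceParabolicIndGL                    -- ★ the GL-currency frame of van Dijk's formula (`parabolicIndGL`, `standardLeviGL`, `glInt`, `unipotentRadicalGL`, `rootDeltaChar`)
import HarnessLib

/-!
# R90 · S3 · hand S3-p13 — JUNCTION for E's print socket 6 `stub_R90_S3_print_4131b_vanDijkSplit`: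
# «van Dijk for the NAMED split transfer, summed over the packet» ⟸ (VD) vector van Dijk on `GL₃(L_w)` + (J1) the `σ`-side dictionary + (J2) the `G`-side
# transport along `e′ : G′_v ≃ GL₃(L_w)` + (J3) the finite `ℤ`-expansion of `Tr (i_G σ̃ ∘ e′)` in irreducible characters

R90-TF section S3 (dealer R90-C12-plan (g0), RULING S3-R10 «VD₂ RE-SIZED + JUNCTION-FIRST», 2026-09-04T22:21:11Z (3)); seat K2E3-p17 (g10); crux H413 =
`stmt-HodgeConjecture-24833` (lane `--kind proof --supports … --as helper`, supports-only).  THEOREMS ONLY (no `def`, no instance, no notation, no named fact,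
no `sorry`); imports ★ Literature only (Theorems never import `Cruxes/…/Lines`) — exactly the pattern of D's `endoExpansion_exists_of` and of ★ (R-ii)
`R90.S3.endoExpansion_exists_split_of_stable_of_vanDijk` (`Theorems/R90S3EndoExpansionSplit.lean`).

THE SOCKET (E ED. 2 :430 ff., `Lines/R90_S3_PrintInputsE.lean`): at a place `v` of `L⁺` and every `w ∣ v` with `c • w ≠ w` (so `G′_v ≃ GL₃(L_w)` by ★
`localSplitEquiv` =: `e′`, `H_v ≃ GL₂(L_w) × GL₁(L_w) = M_{(2,1)}`), for every finset `ρ` of classes of `H_v` there is a finitely supported `c : Irr(G′_v) →₀ ℤ`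
with `Σ_{σ∈ρ} Tr σ(τ_v · f̄^P) = Σ_π c(π) Tr π(f)` for all `f ∈ C_c^∞(G′_v)`, `τ_v · f̄^P` = ★ `UnitaryGroup.cmSplitTransfer L H′ hH′ hH′d v w hw μ νH νG f`
[Rogawski1990, §4.13 Lemma 4.13.1 (b) p. 64; §13.8 p. 217 (∗)].  THE JUNCTION `print_4131b_vanDijkSplit_of` derives the socket's CONCLUSION (token for token) from
four hypotheses over the socket's own frame (`hH′ hH′d μ νG νH ρ`; the socket's `hμu hμω hs mH mG hm hT hρ` are orbital-side ∕ key binders not needed for the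
identity — as for ★ (R-ii), the payment term at E simply ignores them):
* (VD) `hVD` — **vector-valued van Dijk on `GL₃(L_w)` for the `(2,1)` parabolic** = the (VD₂) HEAD of record (RULING S3-R10 (2): `GLn.vanDijkTraceParabolicIndGL_admissible`,
  line owner R90-C14-p01 (g0) over ★ p862502 (KMU-σ) of K2E3-p21 (g9)) SPECIALISED to `F := L_w`, `N := 3`, `c := Zelevinsky1980.lastBlockLabel 3`, in K2E3-p24's
  TWISTED `σ_M` spelling of record `twist (σ̃ ∘ proj ∘ incl_{M_c}) (δ_{P}^{1∕2} ∘ incl_{M_c})` (★ `GLn.smoothTrace_twist_comp_leviProjection_eq_fibreIntegral`), for ALL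
  Haar `ν` on `GL₃(L_w)` and `ν_M` on `M_c`, with the Iwasawa constant `ν(K) ∕ ν_M(M_c ∩ K)` INSIDE and the unit-mass `K × U_c` measure spelled ★
  `UnitaryGroup.splitKUMeasure L_w` (= `κ¹ ⊗ μ¹_U`, ★ `cmConstantTermSplit`'s own spelling): for admissible `σ̃` on any `W`,
  `tr (i_c σ̃)(φ dν) = (ν(K)∕ν_M(M_c ∩ K)) · tr σ̃_M^{tw}(m ↦ ∫_{K × U_c} φ(k (m u) k⁻¹) d(κ¹ ⊗ μ¹_U))`.
* (J1) `hJ1` — **the `σ`-side dictionary** (M, dealable): for every class `σ` of `H_v` there are an irreducible smooth ADMISSIBLE `σ̃` of the block Levi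
  `GL₂(L_w) × GL₁(L_w)` (the transport of `σ ⊗ (μ_w ∘ det ∘ e₂)` along ★ `cmSplitLeviHom`; admissibility of irreducibles of `H_v` = ★ `LocalIrrepAdmissible` currency)
  and a Haar measure `ν_M` on `M_c` (the transport of `νH`) such that, for every test `f` on `G′_v`,
  `Tr σ(τ_v · f̄^P) = (νG(K′) ∕ ν_M(M_c ∩ K)) · tr σ̃_M^{tw}(m ↦ ∫_{K × U_c} f(e′⁻¹(k (m u) k⁻¹)) d(κ¹ ⊗ μ¹_U))` — the vector twin of ★ `UnitaryGroup.integral_mul_cmSplitTransfer`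
  ∕ ★ `Rogawski1990.XiLocalCharacterSplit`, read off ★ `cmSplitTransfer_apply` + ★ `cmConstantTermSplit_apply` + ★ `smoothTrace_twist` + ★ `smoothTrace_eq_of_equiv`.
* (J2) `hJ2` — **the `G`-side transport along `e′`** (M, dealable): a Haar measure `ν` on `GL₃(L_w)` (the transport of `νG`) with `ν(K) = νG(K′)` (`K′ = e′⁻¹ K` = ★
  `cmSplitMaxCompact`), test functions transport (`f ∈ C_c^∞(G′_v) ⇒ f ∘ e′⁻¹ ∈ C_c^∞(GL₃(L_w))`), and `tr (i_c σ̃ ∘ e′)(f dνG) = tr (i_c σ̃)((f ∘ e′⁻¹) dν)` for admissible `σ̃`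
  (★ `isAdmissible_parabolicIndGL_holds` + transport of structure of ★ `smoothTrace` along a topological-group isomorphism).
* (J3) `hJ3` — **the finite `ℤ`-expansion** (the genuine residual LOCAL input, booked as such in S3-R10 (4)): for every irreducible smooth admissible `σ̃` of the block
  Levi there is a finitely supported `c : Irr(G′_v) →₀ ℤ` with `tr (i_c σ̃ ∘ e′)(f dνG) = Σ_π c(π) Tr π(f)` for all test `f` — finite length of `i_{GL₃}(σ̃)`
  [BernsteinZelevinsky1977, §2.3 ∕ Geometrical Lemma; Casselman §6.3] + Jordan–Hölder additivity of ★ `smoothTrace` + transport of irreducible constituents along `e′`.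
PROOF of the junction: for each `σ`, (J1) then (VD) at `(σ̃, ν, ν_M, φ := f ∘ e′⁻¹)` — the Iwasawa constants agree by (J2)'s `ν(K) = νG(K′)` — then (J2), then (J3) give
`Tr σ(τ_v · f̄^P) = Σ_π c_σ(π) Tr π(f)`; sum over `σ ∈ ρ` with `c := Σ_{σ∈ρ} c_σ` (`Finsupp.sum_finsetSum_index`).

HONEST LABEL: a junction (hypothesis-first assembly) — it pays NOTHING by itself: (VD) is the VD₂ HEAD (GL currency, line R90-C14-p01 ∕ K2E3-p21), (J1)(J2) are dictionary
bricks, (J3) is a genuine residual local input; nothing printed in Ch. 13 is proved here; HC_CM is proved only modulo the 7 printed citations (2 remaining named inputs: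
hLiu418 = stmt-HodgeConjecture-24832, h413 = stmt-HodgeConjecture-24833) until rung 0 closes; REL ≠ ★ ≠ BUILT; count-neutral.
-/

set_option autoImplicit false
-- the mandated namespace repeats the single-problem summit's segment (`HodgeConjecture.HodgeConjecture`)
set_option linter.dupNamespace false

noncomputable section

namespace Summit.HodgeConjecture.HodgeConjecture.R90.S3

open MeasureTheory IsDedekindDomain NumberField
open Literature.NumberTheory Literature.NumberTheory.Automorphic Literature.NumberTheory.Automorphic.UnitaryGroup
open Literature.NumberTheory.Rogawski1990 Literature.NumberTheory.GaloisRepresentations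
open scoped Matrix

variable (L : Type) [Field L] [NumberField L] [IsCMField L] (H' : Matrix (Fin 3) (Fin 3) L)
  (v : HeightOneSpectrum (𝓞 ↥(maximalRealSubfield L)))

/-- **JUNCTION `print_4131b_vanDijkSplit_of` — E's print socket 6 `stub_R90_S3_print_4131b_vanDijkSplit` (conclusion token for token) from (VD) vector van Dijk on
`GL₃(L_w)`, (J1) the `σ`-side dictionary, (J2) the `G`-side transport along `e′ = localSplitEquiv`, (J3) the finite `ℤ`-expansion of `tr (i_c σ̃ ∘ e′)`.**  Payment term at
E ∕ A (under the socket's binders): `stub_R90_S3_print_4131b_vanDijkSplit … ρ hρ := print_4131b_vanDijkSplit_of L H' v hH' hH'd μ νG νH ‹VD› ‹J1› ‹J2› ‹J3› ρ`.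
[cite: Rogawski1990, §4.13 Lemma 4.13.1 (a)(b) pp. 64–66; §13.8 p. 217; §13.1 Thm. 13.1.1 (2) p. 198] [cite: vanDijk1972, Thm. p. 237] [cite: BernsteinZelevinsky1977, §2.3] -/
theorem print_4131b_vanDijkSplit_of
    (hH' : (H'.map (cmConjRingHom L))ᵀ = H') (hH'd : IsUnit H'.det)
    (μ : HeckeCharacter L)
    [MeasurableSpace ((UnitaryGroup.cmDatum L 3 H').Local v)] [BorelSpace ((UnitaryGroup.cmDatum L 3 H').Local v)]
    [MeasurableSpace ((UnitaryGroup.cmDatum L 2 (Matrix.of fun i j : Fin 2 => if i.val + j.val + 1 = 2 then (1 : L) else 0)).Local v ×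
      (UnitaryGroup.cmDatum L 1 (Matrix.of fun i j : Fin 1 => if i.val + j.val + 1 = 1 then (1 : L) else 0)).Local v)]
    [BorelSpace ((UnitaryGroup.cmDatum L 2 (Matrix.of fun i j : Fin 2 => if i.val + j.val + 1 = 2 then (1 : L) else 0)).Local v ×
      (UnitaryGroup.cmDatum L 1 (Matrix.of fun i j : Fin 1 => if i.val + j.val + 1 = 1 then (1 : L) else 0)).Local v)]
    (νG : Measure ((UnitaryGroup.cmDatum L 3 H').Local v)) [νG.IsHaarMeasure] [νG.IsMulRightInvariant]
    (νH : Measure ((UnitaryGroup.cmDatum L 2 (Matrix.of fun i j : Fin 2 => if i.val + j.val + 1 = 2 then (1 : L) else 0)).Local v ×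
      (UnitaryGroup.cmDatum L 1 (Matrix.of fun i j : Fin 1 => if i.val + j.val + 1 = 1 then (1 : L) else 0)).Local v))
    [νH.IsHaarMeasure] [νH.IsMulRightInvariant]
    /- (VD) vector-valued van Dijk on `GL₃(L_w)`, `(2,1)` parabolic, p24's TWISTED `σ_M` spelling, Iwasawa constant inside, `K × U_c` measure = ★ `splitKUMeasure` -/
    (hVD : ∀ (w : UnitaryGroup.PlacesOver L v) (W : Type) [AddCommGroup W] [Module ℂ W]
      (σ' : Representation ℂ (Π a, GL {i : Fin 3 // Zelevinsky1980.lastBlockLabel 3 i = a} (w.1.adicCompletion L)) W),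
      σ'.IsAdmissible →
      letI : MeasurableSpace (GL (Fin 3) (w.1.adicCompletion L)) := borel _
      ∀ (ν : Measure (GL (Fin 3) (w.1.adicCompletion L))) [ν.IsHaarMeasure]
        (νM : Measure ↥(standardLeviGL (w.1.adicCompletion L) (Zelevinsky1980.lastBlockLabel 3))) [νM.IsHaarMeasure]
        (φ : GL (Fin 3) (w.1.adicCompletion L) → ℂ), IsLocallyConstant φ → HasCompactSupport φ →
        (Representation.parabolicIndGL (w.1.adicCompletion L) (Zelevinsky1980.lastBlockLabel 3) σ').smoothTrace ν φ =
          (((ν (glInt 3 (w.1.adicCompletion L) : Set (GL (Fin 3) (w.1.adicCompletion L)))).toReal /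
              (νM {m | (m : GL (Fin 3) (w.1.adicCompletion L)) ∈ glInt 3 (w.1.adicCompletion L)}).toReal : ℝ) : ℂ) *
            (Representation.twist
                (σ'.comp ((leviProjection (w.1.adicCompletion L) (Zelevinsky1980.lastBlockLabel 3)).comp
                  (Subgroup.inclusion (standardLeviGL_le (w.1.adicCompletion L) (Zelevinsky1980.lastBlockLabel 3)))))
                ((rootDeltaChar (standardParabolicGL (w.1.adicCompletion L) (Zelevinsky1980.lastBlockLabel 3))).comp
                  (Subgroup.inclusion (standardLeviGL_le (w.1.adicCompletion L) (Zelevinsky1980.lastBlockLabel 3))))).smoothTrace νM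
              (fun m : ↥(standardLeviGL (w.1.adicCompletion L) (Zelevinsky1980.lastBlockLabel 3)) =>
                ∫ q : ↥(glInt 3 (w.1.adicCompletion L)) × ↥(unipotentRadicalGL (w.1.adicCompletion L) (Zelevinsky1980.lastBlockLabel 3)),
                  φ ((q.1 : GL (Fin 3) (w.1.adicCompletion L)) *
                      (((m : GL (Fin 3) (w.1.adicCompletion L))) * (q.2 : GL (Fin 3) (w.1.adicCompletion L))) *
                    (q.1 : GL (Fin 3) (w.1.adicCompletion L))⁻¹)
                  ∂(UnitaryGroup.splitKUMeasure (w.1.adicCompletion L))))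
    /- (J1) the `σ`-side dictionary: `Tr σ(τ_v · f̄^P) = (νG(K′)∕ν_M(M_c ∩ K)) · tr σ̃_M^{tw}(m ↦ ∫_{K × U_c} f(e′⁻¹(k (m u) k⁻¹)))` -/
    (hJ1 : ∀ (w : UnitaryGroup.PlacesOver L v) (hw : IsCMField.complexConj L • w.1 ≠ w.1)
      (σ : IrrClass ((UnitaryGroup.cmDatum L 2 (Matrix.of fun i j : Fin 2 => if i.val + j.val + 1 = 2 then (1 : L) else 0)).Local v ×
        (UnitaryGroup.cmDatum L 1 (Matrix.of fun i j : Fin 1 => if i.val + j.val + 1 = 1 then (1 : L) else 0)).Local v)),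
      ∃ r : SmoothIrrep (Π a, GL {i : Fin 3 // Zelevinsky1980.lastBlockLabel 3 i = a} (w.1.adicCompletion L)),
        r.ρ.IsAdmissible ∧
        letI : MeasurableSpace (GL (Fin 3) (w.1.adicCompletion L)) := borel _
        ∃ νM : Measure ↥(standardLeviGL (w.1.adicCompletion L) (Zelevinsky1980.lastBlockLabel 3)), νM.IsHaarMeasure ∧
          ∀ f : (UnitaryGroup.cmDatum L 3 H').Local v → ℂ, IsLocSmooth f →
            σ.smoothTrace νH (UnitaryGroup.cmSplitTransfer L H' hH' hH'd v w hw μ νH νG f) =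
              (((νG (UnitaryGroup.cmSplitMaxCompact L v w hw H' hH' hH'd :
                    Set ((UnitaryGroup.cmDatum L 3 H').Local v))).toReal /
                  (νM {m | (m : GL (Fin 3) (w.1.adicCompletion L)) ∈ glInt 3 (w.1.adicCompletion L)}).toReal : ℝ) : ℂ) *
                (Representation.twist
                    (r.ρ.comp ((leviProjection (w.1.adicCompletion L) (Zelevinsky1980.lastBlockLabel 3)).comp
                      (Subgroup.inclusion (standardLeviGL_le (w.1.adicCompletion L) (Zelevinsky1980.lastBlockLabel 3)))))
                    ((rootDeltaChar (standardParabolicGL (w.1.adicCompletion L) (Zelevinsky1980.lastBlockLabel 3))).comp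
                      (Subgroup.inclusion (standardLeviGL_le (w.1.adicCompletion L) (Zelevinsky1980.lastBlockLabel 3))))).smoothTrace νM
                  (fun m : ↥(standardLeviGL (w.1.adicCompletion L) (Zelevinsky1980.lastBlockLabel 3)) =>
                    ∫ q : ↥(glInt 3 (w.1.adicCompletion L)) × ↥(unipotentRadicalGL (w.1.adicCompletion L) (Zelevinsky1980.lastBlockLabel 3)),
                      f ((UnitaryGroup.localSplitEquiv (IsCMField.complexConj L) H' (IsCMField.complexConj_ne_one L)
                          ((UnitaryGroup.map_cmConjRingHom_eq_map_complexConj L H') ▸ hH') w hw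
                          (UnitaryGroup.isUnit_placeForm_of_isUnit_det hH'd w.1)).symm
                        ((q.1 : GL (Fin 3) (w.1.adicCompletion L)) *
                            (((m : GL (Fin 3) (w.1.adicCompletion L))) * (q.2 : GL (Fin 3) (w.1.adicCompletion L))) *
                          (q.1 : GL (Fin 3) (w.1.adicCompletion L))⁻¹))
                      ∂(UnitaryGroup.splitKUMeasure (w.1.adicCompletion L))))
    /- (J2) the `G`-side transport along `e′`: a Haar `ν` on `GL₃(L_w)` with `ν(K) = νG(K′)`, test functions transport, `tr (i_c σ̃ ∘ e′)(f dνG) = tr (i_c σ̃)((f ∘ e′⁻¹) dν)` -/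
    (hJ2 : ∀ (w : UnitaryGroup.PlacesOver L v) (hw : IsCMField.complexConj L • w.1 ≠ w.1),
      letI : MeasurableSpace (GL (Fin 3) (w.1.adicCompletion L)) := borel _
      ∃ ν : Measure (GL (Fin 3) (w.1.adicCompletion L)), ν.IsHaarMeasure ∧
        ν (glInt 3 (w.1.adicCompletion L) : Set (GL (Fin 3) (w.1.adicCompletion L))) =
          νG (UnitaryGroup.cmSplitMaxCompact L v w hw H' hH' hH'd : Set ((UnitaryGroup.cmDatum L 3 H').Local v)) ∧
        (∀ f : (UnitaryGroup.cmDatum L 3 H').Local v → ℂ, IsLocSmooth f →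
          IsLocallyConstant (fun x : GL (Fin 3) (w.1.adicCompletion L) =>
              f ((UnitaryGroup.localSplitEquiv (IsCMField.complexConj L) H' (IsCMField.complexConj_ne_one L)
                ((UnitaryGroup.map_cmConjRingHom_eq_map_complexConj L H') ▸ hH') w hw
                (UnitaryGroup.isUnit_placeForm_of_isUnit_det hH'd w.1)).symm x)) ∧
            HasCompactSupport (fun x : GL (Fin 3) (w.1.adicCompletion L) =>
              f ((UnitaryGroup.localSplitEquiv (IsCMField.complexConj L) H' (IsCMField.complexConj_ne_one L)
                ((UnitaryGroup.map_cmConjRingHom_eq_map_complexConj L H') ▸ hH') w hw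
                (UnitaryGroup.isUnit_placeForm_of_isUnit_det hH'd w.1)).symm x))) ∧
        ∀ (W : Type) [AddCommGroup W] [Module ℂ W]
          (σ' : Representation ℂ (Π a, GL {i : Fin 3 // Zelevinsky1980.lastBlockLabel 3 i = a} (w.1.adicCompletion L)) W),
          σ'.IsAdmissible → ∀ f : (UnitaryGroup.cmDatum L 3 H').Local v → ℂ, IsLocSmooth f →
            Representation.smoothTrace (G := (UnitaryGroup.cmDatum L 3 H').Local v)
              ((Representation.parabolicIndGL (w.1.adicCompletion L) (Zelevinsky1980.lastBlockLabel 3) σ').comp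
                (UnitaryGroup.localSplitEquiv (IsCMField.complexConj L) H' (IsCMField.complexConj_ne_one L)
                  ((UnitaryGroup.map_cmConjRingHom_eq_map_complexConj L H') ▸ hH') w hw
                  (UnitaryGroup.isUnit_placeForm_of_isUnit_det hH'd w.1)).toMonoidHom) νG f =
              (Representation.parabolicIndGL (w.1.adicCompletion L) (Zelevinsky1980.lastBlockLabel 3) σ').smoothTrace ν
                (fun x : GL (Fin 3) (w.1.adicCompletion L) =>
                  f ((UnitaryGroup.localSplitEquiv (IsCMField.complexConj L) H' (IsCMField.complexConj_ne_one L)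
                    ((UnitaryGroup.map_cmConjRingHom_eq_map_complexConj L H') ▸ hH') w hw
                    (UnitaryGroup.isUnit_placeForm_of_isUnit_det hH'd w.1)).symm x)))
    /- (J3) the finite `ℤ`-expansion of `tr (i_c σ̃ ∘ e′)` in irreducible characters of `G′_v` (finite length + JH additivity + transport of constituents) -/
    (hJ3 : ∀ (w : UnitaryGroup.PlacesOver L v) (hw : IsCMField.complexConj L • w.1 ≠ w.1)
      (r : SmoothIrrep (Π a, GL {i : Fin 3 // Zelevinsky1980.lastBlockLabel 3 i = a} (w.1.adicCompletion L))),
      r.ρ.IsAdmissible →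
      ∃ c : IrrClass ((UnitaryGroup.cmDatum L 3 H').Local v) →₀ ℤ,
        ∀ f : (UnitaryGroup.cmDatum L 3 H').Local v → ℂ, IsLocSmooth f →
          Representation.smoothTrace (G := (UnitaryGroup.cmDatum L 3 H').Local v)
            ((Representation.parabolicIndGL (w.1.adicCompletion L) (Zelevinsky1980.lastBlockLabel 3) r.ρ).comp
              (UnitaryGroup.localSplitEquiv (IsCMField.complexConj L) H' (IsCMField.complexConj_ne_one L)
                ((UnitaryGroup.map_cmConjRingHom_eq_map_complexConj L H') ▸ hH') w hw
                (UnitaryGroup.isUnit_placeForm_of_isUnit_det hH'd w.1)).toMonoidHom) νG f =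
            ∑ π ∈ c.support, (c π : ℂ) * π.smoothTrace νG f)
    (ρ : Finset (IrrClass ((UnitaryGroup.cmDatum L 2 (Matrix.of fun i j : Fin 2 => if i.val + j.val + 1 = 2 then (1 : L) else 0)).Local v ×
      (UnitaryGroup.cmDatum L 1 (Matrix.of fun i j : Fin 1 => if i.val + j.val + 1 = 1 then (1 : L) else 0)).Local v))) :
    ∀ (w : UnitaryGroup.PlacesOver L v) (hw : IsCMField.complexConj L • w.1 ≠ w.1),
      ∃ c : IrrClass ((UnitaryGroup.cmDatum L 3 H').Local v) →₀ ℤ,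
        ∀ f : (UnitaryGroup.cmDatum L 3 H').Local v → ℂ, IsLocSmooth f →
          ∑ σ ∈ ρ, σ.smoothTrace νH (UnitaryGroup.cmSplitTransfer L H' hH' hH'd v w hw μ νH νG f) =
            ∑ π ∈ c.support, (c π : ℂ) * π.smoothTrace νG f := by
  intro w hw
  classical
  letI : MeasurableSpace (GL (Fin 3) (w.1.adicCompletion L)) := borel _
  -- STEP 1: the expansion for ONE class `σ` of `H_v`
  have key : ∀ σ : IrrClass ((UnitaryGroup.cmDatum L 2 (Matrix.of fun i j : Fin 2 => if i.val + j.val + 1 = 2 then (1 : L) else 0)).Local v ×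
      (UnitaryGroup.cmDatum L 1 (Matrix.of fun i j : Fin 1 => if i.val + j.val + 1 = 1 then (1 : L) else 0)).Local v),
      ∃ c : IrrClass ((UnitaryGroup.cmDatum L 3 H').Local v) →₀ ℤ,
        ∀ f : (UnitaryGroup.cmDatum L 3 H').Local v → ℂ, IsLocSmooth f →
          σ.smoothTrace νH (UnitaryGroup.cmSplitTransfer L H' hH' hH'd v w hw μ νH νG f) =
            ∑ π ∈ c.support, (c π : ℂ) * π.smoothTrace νG f := by
    intro σ
    -- (J1): the dictionary datum `σ̃ = r.ρ`, the transported Haar measure `ν_M` on `M_c` and the trace identity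
    obtain ⟨r, hadm, νM, hνM, h1⟩ := hJ1 w hw σ
    -- (J2): the transported Haar measure `ν` on `GL₃(L_w)`, `ν(K) = νG(K′)`, test-function and trace transport
    obtain ⟨ν, hν, hνK, hφ, h2⟩ := hJ2 w hw
    -- (J3): the finite `ℤ`-expansion of `tr (i_c σ̃ ∘ e′)`
    obtain ⟨c, h3⟩ := hJ3 w hw r hadm
    refine ⟨c, fun f hf => ?_⟩
    haveI : νM.IsHaarMeasure := hνM
    haveI : ν.IsHaarMeasure := hν
    -- (VD) at `(σ̃, ν, ν_M, φ := f ∘ e′⁻¹)`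
    have hv := hVD w r.V r.ρ hadm ν νM
      (fun x : GL (Fin 3) (w.1.adicCompletion L) =>
        f ((UnitaryGroup.localSplitEquiv (IsCMField.complexConj L) H' (IsCMField.complexConj_ne_one L)
          ((UnitaryGroup.map_cmConjRingHom_eq_map_complexConj L H') ▸ hH') w hw
          (UnitaryGroup.isUnit_placeForm_of_isUnit_det hH'd w.1)).symm x))
      (hφ f hf).1 (hφ f hf).2
    beta_reduce at hv
    rw [h1 f hf, ← h3 f hf, h2 r.V r.ρ hadm f hf, hv, hνK]
  -- STEP 2: sum over the packet, `c := Σ_{σ∈ρ} c_σ`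
  choose cσ hcσ using key
  refine ⟨∑ σ ∈ ρ, cσ σ, fun f hf => ?_⟩
  rw [Finset.sum_congr rfl fun σ _ => hcσ σ f hf]
  show ∑ σ ∈ ρ, (cσ σ).sum (fun π n => (n : ℂ) * π.smoothTrace νG f) =
    (∑ σ ∈ ρ, cσ σ).sum (fun π n => (n : ℂ) * π.smoothTrace νG f)
  exact Finsupp.sum_finsetSum_index (fun π => by simp) (fun π b₁ b₂ => by push_cast; ring)

end Summit.HodgeConjecture.HodgeConjecture.R90.S3

end
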